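/-
Copyright (c) 2026 the pub-hodgecm-mathlib formalisation cell (harness21).  Prover seat hodgecm-mathlib-LH7-p04 (g11), 2026-09-02.
Road M6 «ROW 2 ★ DYADIC TWIN» → F3 «TOT-Λ BY OVER-ORDERS» (LEAD F0P3a-plan T14-66; dealer LH4-plan (g8) WORD #69∕#70, DEAL g8-#19a), brick F3-1a «GLUED OVER-ORDERS».
-/
import Mathlib.RingTheory.Valuation.ValuativeRel.Basic
import Mathlib.Topology.Algebra.Valued.ValuativeRel
import Mathlib.RingTheory.Ideal.Quotient.Operations
import Mathlib.RingTheory.LocalRing.Basic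
import Mathlib.Algebra.Ring.Subring.Basic
import Literature.NumberTheory.Automorphic.QuadraticRamifiedOrderUnitIndex   -- ★ A-p19 [T2-c]: `coord_unique` for `O₁ = j𝒪 ⊕ j𝒪θ` (the `θ² = jk` frame; only the frame-free `coord_unique` is used)
import HarnessLib

/-!
# The glued over-orders `G(N″, b, c′) = 𝒪 ×_{𝒪∕ϖ^b} O_{N″}` of a type-(2) order: subring structure, inclusions, `⋆`-stability ⟺ hermitian, and the hermitian lift

Topic `NumberTheory/Automorphic`; namespace `Literature.NumberTheory.Automorphic`.  THEOREMS ONLY (no definition, no instance, no notation, no named fact, no `sorry`).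
Cell `pub/hodgecm-mathlib` (D-0151), crux H413 = `stmt-HodgeConjecture-24833`; road M6 → F3 «TOT-Λ by over-orders» (route (B), gate F3-0 = FIT), brick **F3-1a**.
CURRENCY = the abstract (D0) frame of ★ [T2-c] `QuadraticRamifiedOrderUnitIndex` ∕ `…Monogenic` ∕ `…NormIndex`, made EISENSTEIN-UNIFORM: `𝒪 = 𝒪[E]` (`ValuativeRel E`) with an
involution `σO` and a `σO`-fixed element `ϖO` (the uniformiser of the inert base `F`, so `σϖ = ϖ`); the abstract ramified quadratic ring `O₁ = j𝒪 ⊕ j𝒪·θ` (`hcoord`) with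
`θ² = j a·θ + j k` (a GENERAL Eisenstein relation: `a = 0` is ★ [T2-c]'s frame `θ² = jk` of the tame and W-odd rows, `a ≠ 0` covers the W-unit rows) and an involution `σ₁` over
`σO` FIXING `θ` (a `τ`-fixed uniformiser exists because `K₂ ∕ K₂^τ` is unramified).  NO `2`, NO different, NO `d`: the only field input is the UNRAMIFIED trace-one element `htr`.
HONEST LABEL: HC_CM is proved only modulo the 2 remaining named inputs (hLiu418 24832, h413 24833) until rung 0 closes; elementary commutative algebra, asserts nothing printed;
count-neutral base-layer brick ((O4) is not an organ).

THE MATHEMATICS.  `Π_{N″} := j(ϖ^{N″})·θ` generates the order `O_{N″} = j𝒪 ⊕ j𝒪·Π_{N″} = 𝒪 + ϖ^{N″}O₁` and satisfies `Π² = ϖ^{N″}a·Π + ϖ^{2N″}k`.  For `c′ ∈ 𝒪` with the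
CHARACTER CONGRUENCE `c′² ≡ ϖ^{N″}a c′ + ϖ^{2N″}k (mod ϖ^b)` (so that `Π ↦ c′` is a ring map `O_{N″} → 𝒪∕ϖ^b`), the GLUED ORDER is
`G(N″, b, c′) = {(y, j b₀ + j c₀ Π_{N″}) | y ≡ b₀ + c₀ c′ (mod ϖ^b)} ⊆ 𝒪 × O₁` — F3-0's `O(N″, b, χ′)`, F-a's `(N″, n″, 𝔞)`, and the multiplier ring of a glued lattice (★ (O4-G)
`smul_le_iff_of_glued`).  (§1) `G` is a subring containing the diagonal `𝒪`; its parameters are read back (`G(N″,b,c′) = G(N″,b,c″) ⟺ c′ ≡ c″`; the slices `{y | (y,0) ∈ G} = (ϖ^b)`,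
`pr₂ G = O_{N″}`).  (§2) INCLUSIONS: `G(N, n, c) ⊆ G(N″, b, c′) ⟺ N″ ≤ N ∧ b ≤ n ∧ ϖ^{N−N″}c′ ≡ c (mod ϖ^b)` — which glued orders contain the type-(2) order `R = G(N, n, c)`.
(§3) THE INVOLUTION `⋆ = (σO, σ₁)` maps `G(N″, b, c′)` onto `G(N″, b, σO c′)`, so `G` is `⋆`-STABLE iff `c′` is HERMITIAN, `σO c′ ≡ c′ (mod ϖ^b)`; and a hermitian class has a
`σO`-FIXED representative `c″ = σO(b₀)·c′ + b₀·σO(c′)` (additive Hilbert 90 with the trace-one element `b₀ + σO b₀ = 1`), i.e. one in `𝒪_F` — the DERIVATION of F3-0's ansatz «the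
`⋆`-stable over-orders are the ones with digits in `𝔽_q`», whose count `H(N″, b)` (F3-1b) sums to `phiTHn ∕ phiTHprimen` (586 exact identities, `f3/f30_ansatz.py`).

* §1 `snd_gen_mul_self` (`Π²`), `mem_gluedOrder_iff`, **`exists_subring_coe_eq_glued`**, `gen_mem_glued`, `glued_eq_glued_iff`, `setOf_fst_mem_glued_eq`, `snd_image_glued_eq` (coordinates via ★ `coord_unique`).
* §2 `glued_subset_glued` (⇐), **`glued_subset_glued_iff`**.
* §3 `prodMap_mem_glued`, **`image_prodMap_glued`**, **`image_prodMap_glued_eq_self_iff`**, **`exists_fixed_rep_of_sub_mem_span`**, `exists_map_rep_of_sub_mem_span`.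

## References
* [Neukirch1999] J. Neukirch, *Algebraic Number Theory*, Grundlehren 322 (1999): Ch. I §12 (orders and conductors; fibre products of orders).
* [SerreLocalFields1979] J.-P. Serre, *Local Fields*, GTM 67 (1979): Ch. I §6 Prop. 17–18 (Eisenstein bases); Ch. X §1 (additive Hilbert 90).
* [Jacobowitz1962] R. Jacobowitz, *Hermitian forms over local fields*, Amer. J. Math. 84 (1962): §4, §7.
* [Bass1963] H. Bass, *On the ubiquity of Gorenstein rings*, Math. Z. 82 (1963): §7 (context: glued∕fibre-product orders).
-/

set_option autoImplicit false

open scoped ValuativeRel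

namespace Literature.NumberTheory.Automorphic

variable {E : Type*} [Field E] [ValuativeRel E] {O₁ : Type*} [CommRing O₁] (j : 𝒪[E] →+* O₁) (θ : O₁) {a k : 𝒪[E]} (ϖO : 𝒪[E])
  (hθ : θ * θ = j a * θ + j k) (hcoord : ∀ z : O₁, ∃! bc : 𝒪[E] × 𝒪[E], z = j bc.1 + j bc.2 * θ)

/-! ## §1 The glued orders are orders -/

include hθ in
/-- The Eisenstein generator `Π = j(ϖ^{N″})·θ` of `O_{N″}` satisfies `Π² = j(ϖ^{N″} a)·Π + j(ϖ^{2N″} k)`. [cite: SerreLocalFields1979, Ch. I §6 Prop. 17–18] -/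
theorem snd_gen_mul_self (N'' : ℕ) :
    (j (ϖO ^ N'') * θ) * (j (ϖO ^ N'') * θ) = j (ϖO ^ N'' * a) * (j (ϖO ^ N'') * θ) + j (ϖO ^ (2 * N'') * k) := by
  have h : (j (ϖO ^ N'') * θ) * (j (ϖO ^ N'') * θ) = j (ϖO ^ N'') * j (ϖO ^ N'') * (θ * θ) := by ring
  rw [h, hθ]
  simp only [map_mul, map_pow]
  ring

/-- Membership in the glued order, unfolded. [cite: Neukirch1999, Ch. I §12] -/
theorem mem_gluedOrder_iff (N'' b : ℕ) (c' : 𝒪[E]) (z : 𝒪[E] × O₁) :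
    z ∈ {z : 𝒪[E] × O₁ | ∃ b₀ c₀ : 𝒪[E], z.2 = j b₀ + j c₀ * (j (ϖO ^ N'') * θ) ∧ z.1 - (b₀ + c₀ * c') ∈ Ideal.span {ϖO ^ b}} ↔
      ∃ b₀ c₀ : 𝒪[E], z.2 = j b₀ + j c₀ * (j (ϖO ^ N'') * θ) ∧ z.1 - (b₀ + c₀ * c') ∈ Ideal.span {ϖO ^ b} := Iff.rfl

include hθ in
/-- **(S1) THE GLUED ORDER IS AN ORDER.**  Under the character congruence `c′² ≡ ϖ^{N″}a·c′ + ϖ^{2N″}k (mod ϖ^b)` the set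
`G(N″, b, c′) = {(y, j b₀ + j c₀ Π_{N″}) | y ≡ b₀ + c₀ c′ (mod ϖ^b)}` is a subring of `𝒪 × O₁` (packaged as an existential; no definition). [cite: Neukirch1999, Ch. I §12] [cite: Bass1963, §7] -/
theorem exists_subring_coe_eq_glued (N'' b : ℕ) (c' : 𝒪[E])
    (hc : c' * c' - (ϖO ^ N'' * a * c' + ϖO ^ (2 * N'') * k) ∈ Ideal.span {ϖO ^ b}) :
    ∃ S : Subring (𝒪[E] × O₁), (S : Set (𝒪[E] × O₁)) =
      {z : 𝒪[E] × O₁ | ∃ b₀ c₀ : 𝒪[E], z.2 = j b₀ + j c₀ * (j (ϖO ^ N'') * θ) ∧ z.1 - (b₀ + c₀ * c') ∈ Ideal.span {ϖO ^ b}} := by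
  set I : Ideal 𝒪[E] := Ideal.span {ϖO ^ b} with hI
  set P : O₁ := j (ϖO ^ N'') * θ with hP
  have hP2 : P * P = j (ϖO ^ N'' * a) * P + j (ϖO ^ (2 * N'') * k) := snd_gen_mul_self j θ ϖO hθ N''
  refine ⟨{ carrier := {z : 𝒪[E] × O₁ | ∃ b₀ c₀ : 𝒪[E], z.2 = j b₀ + j c₀ * P ∧ z.1 - (b₀ + c₀ * c') ∈ I},
             mul_mem' := ?_, one_mem' := ?_, add_mem' := ?_, zero_mem' := ?_, neg_mem' := ?_ }, rfl⟩
  · rintro ⟨y, x⟩ ⟨y', x'⟩ ⟨b₀, c₀, hx, hy⟩ ⟨b₀', c₀', hx', hy'⟩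
    refine ⟨b₀ * b₀' + c₀ * c₀' * (ϖO ^ (2 * N'') * k), b₀ * c₀' + c₀ * b₀' + c₀ * c₀' * (ϖO ^ N'' * a), ?_, ?_⟩
    · change x * x' = _
      change x = _ at hx
      change x' = _ at hx'
      rw [hx, hx']
      have : (j b₀ + j c₀ * P) * (j b₀' + j c₀' * P) = j b₀ * j b₀' + (j b₀ * j c₀' + j c₀ * j b₀') * P + j c₀ * j c₀' * (P * P) := by ring
      rw [this, hP2]
      simp only [map_add, map_mul]
      ring
    · -- `yy′ − (B₀ + C₀c′) = y(y′ − β′) + β′(y − β) + c₀c₀′·(c′² − ϖ^{N″}ac′ − ϖ^{2N″}k)`, `β = b₀ + c₀c′`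
      have key : y * y' - (b₀ * b₀' + c₀ * c₀' * (ϖO ^ (2 * N'') * k) + (b₀ * c₀' + c₀ * b₀' + c₀ * c₀' * (ϖO ^ N'' * a)) * c') =
          y * (y' - (b₀' + c₀' * c')) + (b₀' + c₀' * c') * (y - (b₀ + c₀ * c')) +
            c₀ * c₀' * (c' * c' - (ϖO ^ N'' * a * c' + ϖO ^ (2 * N'') * k)) := by ring
      change y * y' - _ ∈ I
      change y - _ ∈ I at hy
      change y' - _ ∈ I at hy'
      rw [key]
      exact I.add_mem (I.add_mem (I.mul_mem_left _ hy') (I.mul_mem_left _ hy)) (I.mul_mem_left _ hc)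
  · exact ⟨1, 0, by simp, by simp⟩
  · rintro ⟨y, x⟩ ⟨y', x'⟩ ⟨b₀, c₀, hx, hy⟩ ⟨b₀', c₀', hx', hy'⟩
    change x = _ at hx
    change x' = _ at hx'
    change y - _ ∈ I at hy
    change y' - _ ∈ I at hy'
    refine ⟨b₀ + b₀', c₀ + c₀', ?_, ?_⟩
    · change x + x' = _
      rw [hx, hx', map_add, map_add]; ring
    · change y + y' - _ ∈ I
      have : y + y' - (b₀ + b₀' + (c₀ + c₀') * c') = (y - (b₀ + c₀ * c')) + (y' - (b₀' + c₀' * c')) := by ring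
      rw [this]; exact I.add_mem hy hy'
  · exact ⟨0, 0, by simp, by simp⟩
  · rintro ⟨y, x⟩ ⟨b₀, c₀, hx, hy⟩
    change x = _ at hx
    change y - _ ∈ I at hy
    refine ⟨-b₀, -c₀, ?_, ?_⟩
    · change -x = _
      rw [hx, map_neg, map_neg]; ring
    · change -y - _ ∈ I
      have : -y - (-b₀ + -c₀ * c') = -(y - (b₀ + c₀ * c')) := by ring
      rw [this]; exact I.neg_mem hy

/-- The generator pair `(c′, Π_{N″})` lies in `G(N″, b, c′)`. [cite: Neukirch1999, Ch. I §12] -/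
theorem gen_mem_glued (N'' b : ℕ) (c' : 𝒪[E]) :
    ((c', j (ϖO ^ N'') * θ) : 𝒪[E] × O₁) ∈
      {z : 𝒪[E] × O₁ | ∃ b₀ c₀ : 𝒪[E], z.2 = j b₀ + j c₀ * (j (ϖO ^ N'') * θ) ∧ z.1 - (b₀ + c₀ * c') ∈ Ideal.span {ϖO ^ b}} :=
  ⟨0, 1, by simp, by simp⟩

include hcoord in
/-- **(S1′) parameters are read back**: `G(N″, b, c′) = G(N″, b, c″) ⟺ c′ ≡ c″ (mod ϖ^b)` (for `ϖ^{N″} ≠ 0`, i.e. `𝒪` a domain and `ϖ ≠ 0`). [cite: Neukirch1999, Ch. I §12] -/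
theorem glued_eq_glued_iff (N'' b : ℕ) (c' c'' : 𝒪[E]) (hϖ0 : ϖO ≠ 0) :
    {z : 𝒪[E] × O₁ | ∃ b₀ c₀ : 𝒪[E], z.2 = j b₀ + j c₀ * (j (ϖO ^ N'') * θ) ∧ z.1 - (b₀ + c₀ * c') ∈ Ideal.span {ϖO ^ b}} =
      {z : 𝒪[E] × O₁ | ∃ b₀ c₀ : 𝒪[E], z.2 = j b₀ + j c₀ * (j (ϖO ^ N'') * θ) ∧ z.1 - (b₀ + c₀ * c'') ∈ Ideal.span {ϖO ^ b}} ↔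
      c' - c'' ∈ Ideal.span {ϖO ^ b} := by
  set I : Ideal 𝒪[E] := Ideal.span {ϖO ^ b} with hI
  -- coordinates of `j b₀ + j c₀ Π` w.r.t. `(1, θ)` are `(b₀, c₀ ϖ^{N″})`
  have hcoordP : ∀ b₀ c₀ : 𝒪[E], j b₀ + j c₀ * (j (ϖO ^ N'') * θ) = j b₀ + j (c₀ * ϖO ^ N'') * θ := by
    intro b₀ c₀; rw [map_mul]; ring
  have hread : ∀ {c₁ c₂ : 𝒪[E]}, ((c₁, j (ϖO ^ N'') * θ) : 𝒪[E] × O₁) ∈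
      {z : 𝒪[E] × O₁ | ∃ b₀ c₀ : 𝒪[E], z.2 = j b₀ + j c₀ * (j (ϖO ^ N'') * θ) ∧ z.1 - (b₀ + c₀ * c₂) ∈ I} → c₁ - c₂ ∈ I := by
    rintro c₁ c₂ ⟨b₀, c₀, hx, hy⟩
    simp only at hx hy
    rw [hcoordP, show j (ϖO ^ N'') * θ = j 0 + j (1 * ϖO ^ N'') * θ by simp] at hx
    obtain ⟨hb, hc⟩ := coord_unique j θ hcoord hx
    have hc₀ : c₀ = 1 := by
      have h1 : (1 : 𝒪[E]) * ϖO ^ N'' = c₀ * ϖO ^ N'' := hc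
      exact (mul_right_cancel₀ (pow_ne_zero _ hϖ0) h1).symm
    rw [← hb, hc₀, zero_add, one_mul] at hy
    exact hy
  constructor
  · intro h
    have hmem := gen_mem_glued j θ ϖO N'' b c'
    rw [h] at hmem
    exact hread hmem
  · intro h
    ext ⟨y, x⟩
    simp only [Set.mem_setOf_eq]
    constructor
    · rintro ⟨b₀, c₀, hx, hy⟩
      refine ⟨b₀, c₀, hx, ?_⟩
      have : y - (b₀ + c₀ * c'') = (y - (b₀ + c₀ * c')) + c₀ * (c' - c'') := by ring
      rw [this]; exact I.add_mem hy (I.mul_mem_left _ h)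
    · rintro ⟨b₀, c₀, hx, hy⟩
      refine ⟨b₀, c₀, hx, ?_⟩
      have : y - (b₀ + c₀ * c') = (y - (b₀ + c₀ * c'')) - c₀ * (c' - c'') := by ring
      rw [this]; exact I.sub_mem hy (I.mul_mem_left _ h)

include hcoord in
/-- The `𝒪`-slice: `{y | (y, 0) ∈ G(N″, b, c′)} = (ϖ^b)` — the glue depth `b` is read back (`ϖ ≠ 0`). [cite: Neukirch1999, Ch. I §12] -/
theorem setOf_fst_mem_glued_eq (N'' b : ℕ) (c' : 𝒪[E]) (hϖ0 : ϖO ≠ 0) :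
    {y : 𝒪[E] | ((y, (0 : O₁)) : 𝒪[E] × O₁) ∈
      {z : 𝒪[E] × O₁ | ∃ b₀ c₀ : 𝒪[E], z.2 = j b₀ + j c₀ * (j (ϖO ^ N'') * θ) ∧ z.1 - (b₀ + c₀ * c') ∈ Ideal.span {ϖO ^ b}}} =
      (Ideal.span {ϖO ^ b} : Set 𝒪[E]) := by
  ext y
  simp only [Set.mem_setOf_eq, SetLike.mem_coe]
  constructor
  · rintro ⟨b₀, c₀, hx, hy⟩
    rw [show j b₀ + j c₀ * (j (ϖO ^ N'') * θ) = j b₀ + j (c₀ * ϖO ^ N'') * θ by rw [map_mul]; ring,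
      show (0 : O₁) = j 0 + j 0 * θ by simp] at hx
    obtain ⟨hb, hc⟩ := coord_unique j θ hcoord hx.symm
    have hc₀ : c₀ = 0 := by
      rcases mul_eq_zero.1 hc with h | h
      · exact h
      · exact absurd h (pow_ne_zero _ hϖ0)
    rw [hb, hc₀] at hy
    simpa using hy
  · intro hy
    exact ⟨0, 0, by simp, by simpa using hy⟩

/-- The `O₁`-projection of `G(N″, b, c′)` is the order `O_{N″} = j𝒪 ⊕ j𝒪·Π_{N″}` — the conductor `N″` is read back. [cite: Neukirch1999, Ch. I §12] -/
theorem snd_image_glued_eq (N'' b : ℕ) (c' : 𝒪[E]) :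
    Prod.snd '' {z : 𝒪[E] × O₁ | ∃ b₀ c₀ : 𝒪[E], z.2 = j b₀ + j c₀ * (j (ϖO ^ N'') * θ) ∧ z.1 - (b₀ + c₀ * c') ∈ Ideal.span {ϖO ^ b}} =
      {x : O₁ | ∃ b₀ c₀ : 𝒪[E], x = j b₀ + j c₀ * (j (ϖO ^ N'') * θ)} := by
  ext x
  simp only [Set.mem_image, Set.mem_setOf_eq, Prod.exists, exists_eq_right]
  constructor
  · rintro ⟨y, b₀, c₀, hx, -⟩
    exact ⟨b₀, c₀, hx⟩
  · rintro ⟨b₀, c₀, hx⟩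
    exact ⟨b₀ + c₀ * c', b₀, c₀, hx, by simp⟩

/-! ## §2 Inclusions: which glued orders contain `R = G(N, n, c)` -/

/-- **(S2, ⇐) the glued orders above `R`**: if `N″ ≤ N`, `b ≤ n` and `ϖ^{N−N″}c′ ≡ c (mod ϖ^b)` («compatible») then `G(N, n, c) ⊆ G(N″, b, c′)`
(`Π_N = ϖ^{N−N″}·Π_{N″}`). [cite: Neukirch1999, Ch. I §12] -/
theorem glued_subset_glued {N n N'' b : ℕ} (c c' : 𝒪[E]) (hN : N'' ≤ N) (hb : b ≤ n)
    (hcomp : ϖO ^ (N - N'') * c' - c ∈ Ideal.span {ϖO ^ b}) :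
    {z : 𝒪[E] × O₁ | ∃ b₀ c₀ : 𝒪[E], z.2 = j b₀ + j c₀ * (j (ϖO ^ N) * θ) ∧ z.1 - (b₀ + c₀ * c) ∈ Ideal.span {ϖO ^ n}} ⊆
      {z : 𝒪[E] × O₁ | ∃ b₀ c₀ : 𝒪[E], z.2 = j b₀ + j c₀ * (j (ϖO ^ N'') * θ) ∧ z.1 - (b₀ + c₀ * c') ∈ Ideal.span {ϖO ^ b}} := by
  rintro ⟨y, x⟩ ⟨b₀, c₀, hx, hy⟩
  change x = _ at hx
  change y - _ ∈ _ at hy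
  have hle : Ideal.span {ϖO ^ n} ≤ Ideal.span ({ϖO ^ b} : Set 𝒪[E]) :=
    Ideal.span_singleton_le_span_singleton.2 (pow_dvd_pow ϖO hb)
  refine ⟨b₀, c₀ * ϖO ^ (N - N''), ?_, ?_⟩
  · change x = _
    rw [hx, map_mul, mul_assoc, ← mul_assoc (j (ϖO ^ (N - N''))), ← map_mul, pow_sub_mul_pow ϖO hN]
  · change y - _ ∈ _
    have : y - (b₀ + c₀ * ϖO ^ (N - N'') * c') = (y - (b₀ + c₀ * c)) - c₀ * (ϖO ^ (N - N'') * c' - c) := by ring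
    rw [this]
    exact (Ideal.span {ϖO ^ b}).sub_mem (hle hy) (Ideal.mul_mem_left _ _ hcomp)

include hcoord in
/-- **(S2) INCLUSION CRITERION**: `G(N, n, c) ⊆ G(N″, b, c′) ⟺ N″ ≤ N ∧ b ≤ n ∧ ϖ^{N−N″}c′ ≡ c (mod ϖ^b)` — the over-orders of the type-(2) order among the glued orders
(`ϖ` a nonzero non-unit). [cite: Neukirch1999, Ch. I §12] -/
theorem glued_subset_glued_iff {N n N'' b : ℕ} (c c' : 𝒪[E]) (hϖ0 : ϖO ≠ 0) (hϖu : ¬ IsUnit ϖO) :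
    {z : 𝒪[E] × O₁ | ∃ b₀ c₀ : 𝒪[E], z.2 = j b₀ + j c₀ * (j (ϖO ^ N) * θ) ∧ z.1 - (b₀ + c₀ * c) ∈ Ideal.span {ϖO ^ n}} ⊆
      {z : 𝒪[E] × O₁ | ∃ b₀ c₀ : 𝒪[E], z.2 = j b₀ + j c₀ * (j (ϖO ^ N'') * θ) ∧ z.1 - (b₀ + c₀ * c') ∈ Ideal.span {ϖO ^ b}} ↔
      N'' ≤ N ∧ b ≤ n ∧ ϖO ^ (N - N'') * c' - c ∈ Ideal.span {ϖO ^ b} := by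
  constructor
  · intro h
    -- the generator `(c, Π_N)` of `G(N, n, c)` lies in `G(N″, b, c′)`
    obtain ⟨b₀, c₀, hx, hy⟩ := h (gen_mem_glued j θ ϖO N n c)
    change j (ϖO ^ N) * θ = _ at hx
    change c - _ ∈ _ at hy
    rw [show j b₀ + j c₀ * (j (ϖO ^ N'') * θ) = j b₀ + j (c₀ * ϖO ^ N'') * θ by rw [map_mul]; ring,
      show j (ϖO ^ N) * θ = j 0 + j (ϖO ^ N) * θ by simp] at hx
    obtain ⟨hb₀, hc₀⟩ := coord_unique j θ hcoord hx
    -- `ϖ^N = c₀ ϖ^{N″}` forces `N″ ≤ N` and `c₀ = ϖ^{N−N″}`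
    have hN : N'' ≤ N := by
      by_contra hlt
      rw [not_le] at hlt
      have h1 : ϖO ^ N * 1 = ϖO ^ N * (c₀ * ϖO ^ (N'' - N)) := by
        rw [mul_one, mul_left_comm, ← pow_add, Nat.add_sub_cancel' hlt.le]; exact hc₀
      have h2 : (1 : 𝒪[E]) = c₀ * ϖO ^ (N'' - N) := mul_left_cancel₀ (pow_ne_zero _ hϖ0) h1
      have h3 : ϖO ∣ 1 := by
        rw [h2]; exact Dvd.dvd.mul_left (dvd_pow_self ϖO (Nat.sub_ne_zero_of_lt hlt)) _
      exact hϖu (isUnit_of_dvd_one h3)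
    have hc₀' : c₀ = ϖO ^ (N - N'') := by
      have h1 : c₀ * ϖO ^ N'' = ϖO ^ (N - N'') * ϖO ^ N'' := by rw [pow_sub_mul_pow ϖO hN]; exact hc₀.symm
      exact mul_right_cancel₀ (pow_ne_zero _ hϖ0) h1
    -- the element `(ϖ^n, 0)` of `G(N, n, c)` lies in `G(N″, b, c′)`: `b ≤ n`
    have hmem : ((ϖO ^ n, (0 : O₁)) : 𝒪[E] × O₁) ∈
        {z : 𝒪[E] × O₁ | ∃ b₀ c₀ : 𝒪[E], z.2 = j b₀ + j c₀ * (j (ϖO ^ N) * θ) ∧ z.1 - (b₀ + c₀ * c) ∈ Ideal.span {ϖO ^ n}} :=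
      ⟨0, 0, by simp, by simp⟩
    have hmem' := h hmem
    have hϖn : ϖO ^ n ∈ Ideal.span ({ϖO ^ b} : Set 𝒪[E]) := by
      have := setOf_fst_mem_glued_eq j θ ϖO hcoord N'' b c' hϖ0
      have h' : ϖO ^ n ∈ {y : 𝒪[E] | ((y, (0 : O₁)) : 𝒪[E] × O₁) ∈
          {z : 𝒪[E] × O₁ | ∃ b₀ c₀ : 𝒪[E], z.2 = j b₀ + j c₀ * (j (ϖO ^ N'') * θ) ∧ z.1 - (b₀ + c₀ * c') ∈ Ideal.span {ϖO ^ b}}} := hmem'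
      rw [this] at h'
      exact h'
    have hbn : b ≤ n := (pow_dvd_pow_iff hϖ0 hϖu).1 (Ideal.mem_span_singleton.1 hϖn)
    refine ⟨hN, hbn, ?_⟩
    rw [← hb₀, hc₀', zero_add] at hy
    have : ϖO ^ (N - N'') * c' - c = -(c - ϖO ^ (N - N'') * c') := by ring
    rw [this]
    exact (Ideal.span {ϖO ^ b}).neg_mem hy
  · rintro ⟨hN, hb, hcomp⟩
    exact glued_subset_glued j θ ϖO c c' hN hb hcomp

/-! ## §3 `⋆`-stability ⟺ hermitian, and the hermitian lift -/

section Star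

variable (σO : 𝒪[E] →+* 𝒪[E]) (σ₁ : O₁ →+* O₁)
  (hσσ : ∀ x, σO (σO x) = x) (hσ₁j : ∀ x, σ₁ (j x) = j (σO x)) (hσ₁θ : σ₁ θ = θ) (hσϖ : σO ϖO = ϖO)

include hσ₁j hσ₁θ hσϖ in
/-- `⋆ = (σO, σ₁)` maps `G(N″, b, c′)` INTO `G(N″, b, σO c′)` (`σ₁` fixes the Eisenstein generator `Π_{N″}` because it fixes `θ` and `ϖ`). [cite: Jacobowitz1962, §4] -/
theorem prodMap_mem_glued (N'' b : ℕ) (c' : 𝒪[E]) {z : 𝒪[E] × O₁}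
    (hz : z ∈ {z : 𝒪[E] × O₁ | ∃ b₀ c₀ : 𝒪[E], z.2 = j b₀ + j c₀ * (j (ϖO ^ N'') * θ) ∧ z.1 - (b₀ + c₀ * c') ∈ Ideal.span {ϖO ^ b}}) :
    RingHom.prodMap σO σ₁ z ∈
      {z : 𝒪[E] × O₁ | ∃ b₀ c₀ : 𝒪[E], z.2 = j b₀ + j c₀ * (j (ϖO ^ N'') * θ) ∧ z.1 - (b₀ + c₀ * σO c') ∈ Ideal.span {ϖO ^ b}} := by
  obtain ⟨y, x⟩ := z
  obtain ⟨b₀, c₀, hx, hy⟩ := hz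
  change x = _ at hx
  change y - _ ∈ _ at hy
  refine ⟨σO b₀, σO c₀, ?_, ?_⟩
  · change σ₁ x = _
    rw [hx, map_add, map_mul, map_mul, hσ₁j, hσ₁j, hσ₁j, hσ₁θ, map_pow, hσϖ]
  · change σO y - _ ∈ _
    obtain ⟨t, ht⟩ := Ideal.mem_span_singleton'.1 hy
    refine Ideal.mem_span_singleton'.2 ⟨σO t, ?_⟩
    have : σO y - (σO b₀ + σO c₀ * σO c') = σO (y - (b₀ + c₀ * c')) := by simp
    rw [this, ← ht, map_mul, map_pow, hσϖ]

include hcoord hσσ hσ₁j hσ₁θ hσϖ in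
/-- **(S3) THE INVOLUTION ON GLUED ORDERS**: `⋆(G(N″, b, c′)) = G(N″, b, σO c′)`. [cite: Jacobowitz1962, §4] [cite: Neukirch1999, Ch. I §12] -/
theorem image_prodMap_glued (N'' b : ℕ) (c' : 𝒪[E]) :
    RingHom.prodMap σO σ₁ '' {z : 𝒪[E] × O₁ | ∃ b₀ c₀ : 𝒪[E], z.2 = j b₀ + j c₀ * (j (ϖO ^ N'') * θ) ∧ z.1 - (b₀ + c₀ * c') ∈ Ideal.span {ϖO ^ b}} =
      {z : 𝒪[E] × O₁ | ∃ b₀ c₀ : 𝒪[E], z.2 = j b₀ + j c₀ * (j (ϖO ^ N'') * θ) ∧ z.1 - (b₀ + c₀ * σO c') ∈ Ideal.span {ϖO ^ b}} := by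
  -- `σ₁` is an involution (it is `σO` on coordinates)
  have hσ₁σ₁ : ∀ w : O₁, σ₁ (σ₁ w) = w := by
    intro w
    obtain ⟨⟨b₁, c₁⟩, hw, -⟩ := hcoord w
    rw [hw]
    simp only [map_add, map_mul, hσ₁j, hσ₁θ, hσσ]
  have hinv : ∀ w : 𝒪[E] × O₁, RingHom.prodMap σO σ₁ (RingHom.prodMap σO σ₁ w) = w := by
    rintro ⟨y, x⟩; ext <;> simp [hσσ, hσ₁σ₁]
  apply Set.Subset.antisymm
  · rintro _ ⟨z, hz, rfl⟩
    exact prodMap_mem_glued j θ ϖO σO σ₁ hσ₁j hσ₁θ hσϖ N'' b c' hz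
  · intro w hw
    refine ⟨RingHom.prodMap σO σ₁ w, ?_, hinv w⟩
    have h := prodMap_mem_glued j θ ϖO σO σ₁ hσ₁j hσ₁θ hσϖ N'' b (σO c') hw
    rwa [hσσ] at h

include hcoord hσσ hσ₁j hσ₁θ hσϖ in
/-- **(S3′) `⋆`-STABLE ⟺ HERMITIAN**: `⋆(G(N″, b, c′)) = G(N″, b, c′) ⟺ σO c′ ≡ c′ (mod ϖ^b)` — the glued over-order is stable under the involution iff its character value is
hermitian.  This is the DERIVATION of F3-0's ansatz «the good over-orders are the `⋆`-stable ones». [cite: Jacobowitz1962, §4, §7] -/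
theorem image_prodMap_glued_eq_self_iff (N'' b : ℕ) (c' : 𝒪[E]) (hϖ0 : ϖO ≠ 0) :
    RingHom.prodMap σO σ₁ '' {z : 𝒪[E] × O₁ | ∃ b₀ c₀ : 𝒪[E], z.2 = j b₀ + j c₀ * (j (ϖO ^ N'') * θ) ∧ z.1 - (b₀ + c₀ * c') ∈ Ideal.span {ϖO ^ b}} =
      {z : 𝒪[E] × O₁ | ∃ b₀ c₀ : 𝒪[E], z.2 = j b₀ + j c₀ * (j (ϖO ^ N'') * θ) ∧ z.1 - (b₀ + c₀ * c') ∈ Ideal.span {ϖO ^ b}} ↔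
      σO c' - c' ∈ Ideal.span {ϖO ^ b} := by
  rw [image_prodMap_glued j θ ϖO hcoord σO σ₁ hσσ hσ₁j hσ₁θ hσϖ, glued_eq_glued_iff j θ ϖO hcoord N'' b (σO c') c' hϖ0]

include hσσ in
/-- **(S4) THE HERMITIAN LIFT** (additive Hilbert 90 with the UNRAMIFIED trace-one element `b₀ + σO b₀ = 1`): a hermitian class `σO c′ ≡ c′ (mod ϖ^b)` has the `σO`-FIXED
representative `c″ = σO(b₀)·c′ + b₀·σO(c′)`.  2-free (no `½`). [cite: SerreLocalFields1979, Ch. X §1] -/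
theorem exists_fixed_rep_of_sub_mem_span (htr : ∃ b₀ : 𝒪[E], b₀ + σO b₀ = 1) {b : ℕ} {c' : 𝒪[E]}
    (h : σO c' - c' ∈ Ideal.span ({ϖO ^ b} : Set 𝒪[E])) :
    ∃ c'' : 𝒪[E], σO c'' = c'' ∧ c'' - c' ∈ Ideal.span ({ϖO ^ b} : Set 𝒪[E]) := by
  obtain ⟨b₀, hb₀⟩ := htr
  refine ⟨σO b₀ * c' + b₀ * σO c', ?_, ?_⟩
  · rw [map_add, map_mul, map_mul, hσσ, hσσ]; ring
  · have : σO b₀ * c' + b₀ * σO c' - c' = b₀ * (σO c' - c') + (b₀ + σO b₀ - 1) * c' := by ring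
    rw [this, hb₀, sub_self, zero_mul, add_zero]
    exact Ideal.mul_mem_left _ _ h

include hσσ in
/-- (S4, corollary) … hence a representative in the fixed ring `𝒪_F = ιO(𝒪[F])` (`hfixO`: the `σO`-fixed elements of `𝒪_E` come from `𝒪_F`): the `⋆`-stable glued over-orders
are exactly the `G(N″, b, ιO y)`, `y ∈ 𝒪_F` — «digits in `𝔽_q`». [cite: SerreLocalFields1979, Ch. X §1] -/
theorem exists_map_rep_of_sub_mem_span {F : Type*} [Field F] [ValuativeRel F] (ιO : 𝒪[F] →+* 𝒪[E])
    (hfixO : ∀ x, σO x = x → ∃ y, ιO y = x) (htr : ∃ b₀ : 𝒪[E], b₀ + σO b₀ = 1) {b : ℕ} {c' : 𝒪[E]}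
    (h : σO c' - c' ∈ Ideal.span ({ϖO ^ b} : Set 𝒪[E])) :
    ∃ y : 𝒪[F], ιO y - c' ∈ Ideal.span ({ϖO ^ b} : Set 𝒪[E]) := by
  obtain ⟨c'', hfix, hc''⟩ := exists_fixed_rep_of_sub_mem_span ϖO σO hσσ htr h
  obtain ⟨y, hy⟩ := hfixO c'' hfix
  exact ⟨y, hy ▸ hc''⟩

end Star

end Literature.NumberTheory.Automorphic
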